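import Summits.CriticalPhenomena.SAWScalingLimit.Theses.SAWReversalUpgrade
import Literature.Probability.RandomPlanarGeometry.DrivingConvergenceEngine
import HarnessLib

/-!
# Stub `stub_drivingCoupling` of line `lsw-engine` for the crux `ForwardDriving`
(stmt-CriticalPhenomena-18003, route SAWReversalUpgrade)

S2 (M): the engine application — valid raw driving data with κ = 8/3 give, eventually in δ, a
coupling of the law of the driving function with the time-scaled Wiener law (LSW04 Thm 3.7 via
`SkorokhodEmbedding.exists_delta_forall_coupling_lt`).
-/

noncomputable section

namespace Summit.CriticalPhenomena.SAWScalingLimit.Cruxes.ForwardDriving.LswEngine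

open scoped BigOperators Topology Classical MeasureTheory ProbabilityTheory NNReal ENNReal
open scoped Literature.Probability.RandomPlanarGeometry.PathBorel
open Filter Set Function TopologicalSpace MeasureTheory

/-- S2 (M): the engine application — valid raw driving data with κ = 8/3 give, for all
`ε₂ ε₃ > 0` and all small δ, a coupling of the law of the driving function with the time-scaled
Wiener law `t ↦ B(8t/3)` that charges a sup-deviation `> ε₂` on `[0, T]` by `< ε₃`
(`exists_delta_forall_coupling_lt`).
[cite: LawlerSchrammWerner2004, Theorem 3.7] -/
theorem stub_drivingCoupling :
    ∀ (D : Literature.Probability.RandomPlanarGeometry.DobrushinDomain) (a b : ℝ → Literature.Probability.LatticeModels.Site 2) (φ : Literature.Probability.RandomPlanarGeometry.ConformalEquiv UpperHalfPlane.upperHalfPlaneSet D.carrier) (att : ((δ : ℝ) → Literature.Probability.RandomPlanarGeometry.SAW.DomainSAW (D).carrier δ (a δ) (b δ) → Literature.Probability.RandomPlanarGeometry.Curve ℂ)) (T : NNReal), (∃ (Λ : Type) (_ : DecidableEq Λ) (_ : MeasurableSpace Λ) (_ : Countable Λ) (_ : MeasurableSingletonClass Λ) (C₁ C₂ : ℝ)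 (RD : (δ : ℝ) → Literature.Probability.RandomPlanarGeometry.SkorokhodEmbedding.RawDrivingData (Literature.Probability.RandomPlanarGeometry.SAW.DomainSAW D.carrier δ (a δ) (b δ)) Λ) (N : ℝ → ℕ), 0 ≤ C₁ ∧ 0 ≤ C₂ ∧ (∀ δ, (RD δ).P = Literature.Probability.RandomPlanarGeometry.SAW.law D.carrier δ (a δ) (b δ) ∧ (RD δ).κ = 8/3 ∧ (RD δ).C₁ ≤ C₁ ∧ (RD δ).C₂ ≤ C₂ ∧ (RD δ).drv = fun γ => (⟨Literature.Probability.RandomPlanarGeometry.drivingFunction φ (Literature.Probability.RandomPlanarGeometry.CurveClass.mk (att δ γ)), Literature.Probability.RandomPlanarGeometry.continuous_drivingFunction φ (Literature.Probability.RandomPlanarGeometry.CurveClass.mk (att δ γ))⟩ : C(NNReal, ℝ))) ∧ Filter.Tendsto (fun δ => (RD δ).δ) (nhdsWithin 0 (Set.Ioi 0)) (nhds 0) ∧ Filter.Tendsto (fun δ => (RD δ).P {ω | ∃ k < N δ, ((RD δ).dval (k+1) ω - (RD δ).dval k ω)^2 + (((RD δ).tcap (k+1) ω : ℝ) - (RD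 δ).tcap k ω) < (RD δ).δ^2}) (nhdsWithin 0 (Set.Ioi 0)) (nhds 0) ∧ ∀ᶠ δ in nhdsWithin 0 (Set.Ioi 0), ∃ (_ : Fintype (Literature.Probability.RandomPlanarGeometry.SAW.DomainSAW D.carrier δ (a δ) (b δ))), (RD δ).IsValid (N δ) ∧ (8/3 + 2) * (T : ℝ) + 1 ≤ (N δ : ℝ) * (RD δ).δ^2 ∧ (N δ : ℝ) * (RD δ).δ^2 ≤ (8/3 + 2) * (T : ℝ) + 2) → (∀ ε₂ ε₃ : ℝ, 0 < ε₂ → 0 < ε₃ → ∀ᶠ δ in nhdsWithin 0 (Set.Ioi 0), ∃ ρ : MeasureTheory.Measure (C(NNReal, ℝ) × C(NNReal, ℝ)), MeasureTheory.IsProbabilityMeasure ρ ∧ ρ.fst = (Literature.Probability.RandomPlanarGeometry.SAW.law D.carrier δ (a δ) (b δ)).map (fun γ => (⟨Literature.Probability.RandomPlanarGeometry.drivingFunction φ (Literature.Probability.RandomPlanarGeometry.CurveClass.mk (att δ γ)), Literature.Probability.RandomPlanarGeometry.continuous_drivingFunction φ (Literature.Probability.RandomPlanarGeometry.CurveClass.mk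 (att δ γ))⟩ : C(NNReal, ℝ))) ∧ ρ.snd = Literature.Probability.RandomPlanarGeometry.wienerLawC.map (Literature.Probability.RandomPlanarGeometry.SkorokhodEmbedding.timeScale ((8:NNReal)/3)) ∧ ρ {p | ∃ t : NNReal, (t : ℝ) ≤ (T : ℝ) ∧ ε₂ < dist (p.1 t) (p.2 t)} < ENNReal.ofReal ε₃) := by
  intro D a b φ att T hS1 ε₂ ε₃ hε₂ hε₃
  obtain ⟨Λ, i1, i2, i3, i4, C₁, C₂, RD, N, hC₁, hC₂, hdata, hδ, hlow, hval⟩ := hS1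
  -- the engine ([LSW04] Thm. 3.7 for abstract driving data) with `κ = 8/3` and error `ε₃ / 2`
  obtain ⟨δ₀, hδ₀, hcoup⟩ :=
    Literature.Probability.RandomPlanarGeometry.SkorokhodEmbedding.exists_delta_forall_coupling_lt
      hε₂ (half_pos hε₃) T.coe_nonneg (by norm_num : (0 : ℝ) ≤ 8 / 3) hC₁ hC₂
  -- eventually: mesh `≤ δ₀`, and the lower-bound failure event has probability `< ε₃ / 2`
  have h1 : ∀ᶠ δ in nhdsWithin 0 (Set.Ioi 0), (RD δ).δ ≤ δ₀ :=
    hδ.eventually (eventually_le_nhds hδ₀)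
  have h2 : ∀ᶠ δ in nhdsWithin 0 (Set.Ioi 0),
      (RD δ).P {ω | ∃ k < N δ, ((RD δ).dval (k + 1) ω - (RD δ).dval k ω) ^ 2 +
        (((RD δ).tcap (k + 1) ω : ℝ) - (RD δ).tcap k ω) < (RD δ).δ ^ 2} <
        ENNReal.ofReal (ε₃ / 2) :=
    hlow.eventually (gt_mem_nhds (ENNReal.ofReal_pos.2 (half_pos hε₃)))
  filter_upwards [h1, h2, hval] with δ hδ1 hδ2 ⟨inst, hV, hlo, hhi⟩
  obtain ⟨hP, hκ, hC₁', hC₂', hdrv⟩ := hdata δ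
  haveI : MeasureTheory.IsProbabilityMeasure (RD δ).P := hV.prob
  haveI := MeasureTheory.nonempty_of_isProbabilityMeasure (RD δ).P
  haveI : MeasurableSingletonClass
      (Literature.Probability.RandomPlanarGeometry.SAW.DomainSAW D.carrier δ (a δ) (b δ)) :=
    ⟨fun _ => MeasurableSpace.measurableSet_top⟩
  -- apply the engine to the driving data built from the raw data (compensated martingale)
  open Literature.Probability.RandomPlanarGeometry.SkorokhodEmbedding in
  obtain ⟨ρ, hρ, hfst, hsnd, hlt⟩ := hcoup _ Λ (RD δ).toDrivingData (N δ)
    (RawDrivingData.isValid_toDrivingData hV) hκ hC₁' hC₂' hδ1 hlo hhi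
  refine ⟨ρ, hρ, ?_, ?_, ?_⟩
  · -- first marginal: the law of the driving function of the SAW
    open Literature.Probability.RandomPlanarGeometry.SkorokhodEmbedding.RawDrivingData in
    rw [hfst, toDrivingData_P, toDrivingData_drv, hP, hdrv]
  · -- second marginal: the law of `t ↦ B(8t/3)`
    have h83 : (8 : NNReal) / 3 = ⟨(8 / 3 : ℝ), (by norm_num : (0 : ℝ) ≤ 8 / 3)⟩ :=
      NNReal.eq (by push_cast; rfl)
    rw [hsnd, h83]
  · -- the deviation bound: `ε₃ / 2 + P(lowerFailSet) ≤ ε₃ / 2 + ε₃ / 2 = ε₃`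
    have h3 : (RD δ).toDrivingData.P ((RD δ).toDrivingData.lowerFailSet (N δ)) <
        ENNReal.ofReal (ε₃ / 2) := hδ2
    refine hlt.trans_le ((add_le_add le_rfl h3.le).trans_eq ?_)
    rw [← ENNReal.ofReal_add (by positivity) (by positivity)]
    congr 1
    ring

end Summit.CriticalPhenomena.SAWScalingLimit.Cruxes.ForwardDriving.LswEngine

end
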